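import Summits.CriticalPhenomena.SAWScalingLimit.Theorems.LeftRightFKG.Negative.RectDomain
import Literature.Probability.Percolation.FourArmGarbanSquareDomain
import HarnessLib

/-!
# Negative knowledge on crux `LeftRightFKG`, part 7b: the discrete domain of a rectangular lattice domain

Completion of the generic rectangle carrier of part 7 (`RectDomain`, which identifies the mesh VERTICES
of `Ω = {wind(C, ·) ≠ 0}` for a closed lattice walk `C` tracing the boundary of `[x₀, x₁] × [y₀, y₁]`):
for ANY plane set `Ω` containing the open rectangle whose mesh-`1` vertices are exactly the open box of sites
`(x₀, x₁) × (y₀, y₁)`, the mesh graph on the box is connected (`Rect.meshVertexGraph_preconnected_of_box`),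
so the discrete domain (largest component) is the whole box (`Rect.meshDomain_eq_of_box`) and adjacency in
`discreteDomainGraph Ω 1` is lattice adjacency inside the box (`Rect.dAdj_iff_of_box`); specialised to
`Ω = Rect.Ω C` under the decidable boundary-walk hypotheses of part 7 (`Rect.meshDomain_Ω`, `Rect.dAdj_iff`,
`Rect.support_subset_box`).  This is the carrier identification every certified finite instance of the crux
on a box (positive certificate or counterexample) needs; the `5 × 4` and `3 × 3` special cases are parts 4
(`BoxMesh`) and `NotFKGAtOne/Negative/Box3Domain`.  Everything proved, elementary ("folklore").
-/

noncomputable section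

open Real Set Complex Literature.Probability.LatticeModels Literature.Probability.RandomPlanarGeometry
  Literature.Topology.PlaneTopology

namespace Summit.CriticalPhenomena.SAWScalingLimit.Theorems.LeftRightFKG.Negative

namespace Rect

variable {x₀ x₁ y₀ y₁ : ℤ} {Ω' : Set ℂ}

/-! ## Any `Ω` containing the open rectangle, with the box as mesh vertices -/

/-- Box sites lie in the open rectangle. [folklore] -/
theorem pt_mem_Rint_of_box {x : Site 2} (hx : x ∈ box x₀ x₁ y₀ y₁) : pt x ∈ Rint x₀ x₁ y₀ y₁ := by
  obtain ⟨⟨h1, h2⟩, h3, h4⟩ := hx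
  simp only [Rint, mem_setOf_eq, pt_re, pt_im]
  refine ⟨⟨?_, ?_⟩, ?_, ?_⟩ <;> assumption_mod_cast

/-- Lattice neighbours inside the box are mesh-adjacent, for any `Ω` containing the open rectangle (the
unit segment lies in the convex open rectangle `⊆ Ω ⊆ closure Ω`). [folklore] -/
theorem meshGraph_adj_of_box (hR : Rint x₀ x₁ y₀ y₁ ⊆ Ω') {x y : Site 2} (hx : x ∈ box x₀ x₁ y₀ y₁)
    (hy : y ∈ box x₀ x₁ y₀ y₁) (h : (zdGraph 2).Adj x y) : (meshGraph Ω' 1).Adj x y := by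
  refine meshGraph_adj_iff.2 ⟨h, ?_⟩
  rw [meshPoint_one, meshPoint_one]
  exact (convex_Rint.segment_subset (pt_mem_Rint_of_box hx) (pt_mem_Rint_of_box hy)).trans
    (hR.trans subset_closure)

/-- `bx_mem_box` (auxiliary): explicit sites of the box. [folklore] -/
theorem bx_mem_box {i j : ℤ} (hi : x₀ < i ∧ i < x₁) (hj : y₀ < j ∧ j < y₁) : bx i j ∈ box x₀ x₁ y₀ y₁ :=
  ⟨hi, hj⟩

/-- **The mesh graph on the box is connected** (row/column induction from the corner `(x₀+1, y₀+1)`),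
for any `Ω` containing the open rectangle whose mesh vertices are the box. [folklore] -/
theorem meshVertexGraph_preconnected_of_box (hR : Rint x₀ x₁ y₀ y₁ ⊆ Ω')
    (hV : meshVertices Ω' 1 = box x₀ x₁ y₀ y₁) : (meshVertexGraph Ω' 1).Preconnected := by
  set G := meshVertexGraph Ω' 1 with hG
  -- either the box is empty (then the vertex type is empty) or the corner is a vertex
  by_cases hne : x₀ + 1 < x₁ ∧ y₀ + 1 < y₁
  swap
  · intro u v
    exfalso
    have hu : (u : Site 2) ∈ box x₀ x₁ y₀ y₁ := hV ▸ u.2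
    obtain ⟨⟨h1, h2⟩, h3, h4⟩ := hu
    exact hne ⟨by omega, by omega⟩
  obtain ⟨hX, hY⟩ := hne
  have h00 : bx (x₀ + 1) (y₀ + 1) ∈ meshVertices Ω' 1 := by
    rw [hV]; exact bx_mem_box ⟨by omega, hX⟩ ⟨by omega, hY⟩
  have hrow : ∀ k : ℕ, x₀ + 1 + k < x₁ →
      ∃ h : bx (x₀ + 1 + k) (y₀ + 1) ∈ meshVertices Ω' 1, G.Reachable ⟨bx (x₀ + 1) (y₀ + 1), h00⟩ ⟨_, h⟩ := by
    intro k hk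
    induction k with
    | zero => exact ⟨by simpa using h00, by simp⟩
    | succ k ih =>
      obtain ⟨hk', hr⟩ := ih (by push_cast at hk ⊢; omega)
      have hmem : bx (x₀ + 1 + (k + 1 : ℕ)) (y₀ + 1) ∈ meshVertices Ω' 1 := by
        rw [hV]; exact bx_mem_box ⟨by push_cast; omega, hk⟩ ⟨by omega, hY⟩
      refine ⟨hmem, hr.trans (SimpleGraph.Adj.reachable ?_)⟩
      simp only [hG, SimpleGraph.comap_adj, Function.Embedding.coe_subtype]
      exact meshGraph_adj_of_box hR (hV ▸ hk') (hV ▸ hmem)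
        (adj_bx _ _ _ _ (Or.inl ⟨by push_cast; ring, rfl⟩))
  have hcol : ∀ (i k : ℕ), x₀ + 1 + i < x₁ → y₀ + 1 + k < y₁ →
      ∃ h : bx (x₀ + 1 + i) (y₀ + 1 + k) ∈ meshVertices Ω' 1,
        G.Reachable ⟨bx (x₀ + 1) (y₀ + 1), h00⟩ ⟨_, h⟩ := by
    intro i k hi hk
    induction k with
    | zero => obtain ⟨h, hr⟩ := hrow i hi; exact ⟨by simpa using h, by simpa using hr⟩
    | succ k ih =>
      obtain ⟨hk', hr⟩ := ih (by push_cast at hk ⊢; omega)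
      have hmem : bx (x₀ + 1 + i) (y₀ + 1 + (k + 1 : ℕ)) ∈ meshVertices Ω' 1 := by
        rw [hV]; exact bx_mem_box ⟨by omega, hi⟩ ⟨by push_cast; omega, hk⟩
      refine ⟨hmem, hr.trans (SimpleGraph.Adj.reachable ?_)⟩
      simp only [hG, SimpleGraph.comap_adj, Function.Embedding.coe_subtype]
      exact meshGraph_adj_of_box hR (hV ▸ hk') (hV ▸ hmem)
        (adj_bx _ _ _ _ (Or.inr (Or.inr (Or.inl ⟨by push_cast; ring, rfl⟩))))
  have hreach : ∀ v : meshVertices Ω' 1, G.Reachable ⟨bx (x₀ + 1) (y₀ + 1), h00⟩ v := by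
    rintro ⟨v, hv⟩
    have hv' := hv
    rw [hV] at hv'
    obtain ⟨⟨h1, h2⟩, h3, h4⟩ := hv'
    obtain ⟨i, hi⟩ : ∃ i : ℕ, (i : ℤ) = v 0 - (x₀ + 1) := ⟨(v 0 - (x₀ + 1)).toNat, Int.toNat_of_nonneg (by omega)⟩
    obtain ⟨k, hk⟩ : ∃ k : ℕ, (k : ℤ) = v 1 - (y₀ + 1) := ⟨(v 1 - (y₀ + 1)).toNat, Int.toNat_of_nonneg (by omega)⟩
    obtain ⟨h, hr⟩ := hcol i k (by omega) (by omega)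
    have heq : bx (x₀ + 1 + i) (y₀ + 1 + k) = v := by
      rw [eq_bx v]; congr 1 <;> omega
    have hsub : (⟨v, hv⟩ : meshVertices Ω' 1) = ⟨bx (x₀ + 1 + i) (y₀ + 1 + k), h⟩ := Subtype.ext heq.symm
    rw [hsub]
    exact hr
  exact fun u v => (hreach u).symm.trans (hreach v)

/-- **The discrete domain of such an `Ω` is the whole box** (a connected mesh graph is its own largest
component). [folklore] -/
theorem meshDomain_eq_of_box (hR : Rint x₀ x₁ y₀ y₁ ⊆ Ω') (hV : meshVertices Ω' 1 = box x₀ x₁ y₀ y₁) :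
    meshDomain Ω' 1 = box x₀ x₁ y₀ y₁ := by
  rw [Literature.Probability.Percolation.meshDomain_eq_meshVertices_of_preconnected
    (meshVertexGraph_preconnected_of_box hR hV), hV]

/-- **Adjacency in `Ω_1`** is lattice adjacency inside the box, for such an `Ω`. [folklore] -/
theorem dAdj_iff_of_box (hR : Rint x₀ x₁ y₀ y₁ ⊆ Ω') (hV : meshVertices Ω' 1 = box x₀ x₁ y₀ y₁)
    {x y : Site 2} :
    (discreteDomainGraph Ω' 1).Adj x y ↔ (zdGraph 2).Adj x y ∧ x ∈ box x₀ x₁ y₀ y₁ ∧ y ∈ box x₀ x₁ y₀ y₁ := by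
  rw [discreteDomainGraph_adj_iff, meshDomain_eq_of_box hR hV]
  constructor
  · rintro ⟨h, hx, hy⟩
    exact ⟨meshGraph_le_zdGraph _ _ h, hx, hy⟩
  · rintro ⟨h, hx, hy⟩
    exact ⟨meshGraph_adj_of_box hR hx hy h, hx, hy⟩

/-- Walks of `Ω_1` from a box site stay in the box, for such an `Ω`. [folklore] -/
theorem support_subset_box_of_box (hR : Rint x₀ x₁ y₀ y₁ ⊆ Ω') (hV : meshVertices Ω' 1 = box x₀ x₁ y₀ y₁) :
    ∀ {u v : Site 2} (w : (discreteDomainGraph Ω' 1).Walk u v),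
      u ∈ box x₀ x₁ y₀ y₁ → ∀ x ∈ w.support, x ∈ box x₀ x₁ y₀ y₁
  | _, _, SimpleGraph.Walk.nil, hu, x, hx => by
    rw [SimpleGraph.Walk.support_nil, List.mem_singleton] at hx; exact hx ▸ hu
  | _, _, SimpleGraph.Walk.cons h p, hu, x, hx => by
    rw [SimpleGraph.Walk.support_cons, List.mem_cons] at hx
    rcases hx with rfl | hx
    · exact hu
    · exact support_subset_box_of_box hR hV p ((dAdj_iff_of_box hR hV).1 h).2.2 x hx

/-! ## Specialisation to `Ω = {wind(C, ·) ≠ 0}` for a boundary walk of the rectangle -/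

section Boundary

variable {c : Site 2} {C : (zdGraph 2).Walk c c} {m₀ k₀ : ℤ}

/-- **The discrete domain of the crux's `Ω(C)` is the open box**, for a closed lattice walk tracing the
boundary of `[x₀, x₁] × [y₀, y₁]` (hypotheses as in `Rect.meshVertices_Ω`). [folklore] -/
theorem meshDomain_Ω (hb : ∀ x ∈ C.support, (x₀ ≤ x 0 ∧ x 0 ≤ x₁) ∧ (y₀ ≤ x 1 ∧ x 1 ≤ y₁))
    (hch : List.IsChain (fun p q : Site 2 => (p 1 = y₀ ∧ q 1 = y₀) ∨ (p 0 = x₁ ∧ q 0 = x₁) ∨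
      (p 1 = y₁ ∧ q 1 = y₁) ∨ (p 0 = x₀ ∧ q 0 = x₀)) (c :: C.support.tail))
    (hcomp : ∀ i j : ℤ, x₀ ≤ i → i ≤ x₁ → y₀ ≤ j → j ≤ y₁ →
      (i = x₀ ∨ i = x₁ ∨ j = y₀ ∨ j = y₁) → bx i j ∈ C.support)
    (hface : x₀ ≤ m₀ ∧ m₀ + 1 ≤ x₁ ∧ y₀ ≤ k₀ ∧ k₀ + 1 ≤ y₁)
    (hcross : pathCross m₀ k₀ c C.support.tail ≠ 0) : meshDomain (Ω C) 1 = box x₀ x₁ y₀ y₁ :=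
  meshDomain_eq_of_box (Rint_subset_Ω hb hch hface hcross) (meshVertices_Ω hb hch hcomp hface hcross)

/-- **Adjacency in the crux's `Ω(C)_1`** is lattice adjacency inside the open box. [folklore] -/
theorem dAdj_iff (hb : ∀ x ∈ C.support, (x₀ ≤ x 0 ∧ x 0 ≤ x₁) ∧ (y₀ ≤ x 1 ∧ x 1 ≤ y₁))
    (hch : List.IsChain (fun p q : Site 2 => (p 1 = y₀ ∧ q 1 = y₀) ∨ (p 0 = x₁ ∧ q 0 = x₁) ∨
      (p 1 = y₁ ∧ q 1 = y₁) ∨ (p 0 = x₀ ∧ q 0 = x₀)) (c :: C.support.tail))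
    (hcomp : ∀ i j : ℤ, x₀ ≤ i → i ≤ x₁ → y₀ ≤ j → j ≤ y₁ →
      (i = x₀ ∨ i = x₁ ∨ j = y₀ ∨ j = y₁) → bx i j ∈ C.support)
    (hface : x₀ ≤ m₀ ∧ m₀ + 1 ≤ x₁ ∧ y₀ ≤ k₀ ∧ k₀ + 1 ≤ y₁)
    (hcross : pathCross m₀ k₀ c C.support.tail ≠ 0) {x y : Site 2} :
    (discreteDomainGraph (Ω C) 1).Adj x y ↔
      (zdGraph 2).Adj x y ∧ x ∈ box x₀ x₁ y₀ y₁ ∧ y ∈ box x₀ x₁ y₀ y₁ :=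
  dAdj_iff_of_box (Rint_subset_Ω hb hch hface hcross) (meshVertices_Ω hb hch hcomp hface hcross)

/-- Walks of the crux's `Ω(C)_1` from a box site stay in the open box. [folklore] -/
theorem support_subset_box (hb : ∀ x ∈ C.support, (x₀ ≤ x 0 ∧ x 0 ≤ x₁) ∧ (y₀ ≤ x 1 ∧ x 1 ≤ y₁))
    (hch : List.IsChain (fun p q : Site 2 => (p 1 = y₀ ∧ q 1 = y₀) ∨ (p 0 = x₁ ∧ q 0 = x₁) ∨
      (p 1 = y₁ ∧ q 1 = y₁) ∨ (p 0 = x₀ ∧ q 0 = x₀)) (c :: C.support.tail))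
    (hcomp : ∀ i j : ℤ, x₀ ≤ i → i ≤ x₁ → y₀ ≤ j → j ≤ y₁ →
      (i = x₀ ∨ i = x₁ ∨ j = y₀ ∨ j = y₁) → bx i j ∈ C.support)
    (hface : x₀ ≤ m₀ ∧ m₀ + 1 ≤ x₁ ∧ y₀ ≤ k₀ ∧ k₀ + 1 ≤ y₁)
    (hcross : pathCross m₀ k₀ c C.support.tail ≠ 0) {u v : Site 2}
    (w : (discreteDomainGraph (Ω C) 1).Walk u v) (hu : u ∈ box x₀ x₁ y₀ y₁) :
    ∀ x ∈ w.support, x ∈ box x₀ x₁ y₀ y₁ :=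
  support_subset_box_of_box (Rint_subset_Ω hb hch hface hcross) (meshVertices_Ω hb hch hcomp hface hcross) w hu

end Boundary

end Rect

end Summit.CriticalPhenomena.SAWScalingLimit.Theorems.LeftRightFKG.Negative
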